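import Summits.BirchSwinnertonDyer.BirchSwinnertonDyer.Theorems.ResidualThetaTransportAtTwoSignedMuVanishingAtTwoPlusMultOneOldFamilyPrime
import Summits.BirchSwinnertonDyer.BirchSwinnertonDyer.Theorems.ResidualThetaTransportAtTwoSignedMuVanishingAtTwoPlusMultOneCongruence
import HarnessLib

/-!
# Route `ResidualThetaTransportAtTwo`, crux Kμ⁺ `SignedMuVanishingAtTwoPlus` (stmt-BirchSwinnertonDyer-20689), line
# `birth`, stub `stub_flatMuZeroAtTwo`: PER-CLASS TURNKEY for FLAT at 2 at a single level-raising prime — inputs = four named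
# print facts, an anchor curve `A` with `W[2] ≅ A[2]` (kernel certificate), three parities, one odd doubled plus symbol

Cell `bsd-wall`, width seat `bsd-wall-rtt-p4-w2` (g4). THEOREMS ONLY; helper `--supports` the crux; closes nothing. BSD is not proved
by this. This is the END of the (MO⁺)-dictionary chain for habitat⁺ classes `W` whose conductor is `N_A · q` for a congruent
anchor `A` and ONE extra prime `q`: every hypothesis below is either a NAMED PRINT FACT, a KERNEL CERTIFICATE available per class
(`SSUnitAnchor.twoTorsion_congruent_*` of cell `bsd-2adic`; reduction data), a FINITE PARITY CHECK, or the ONE numerical input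
«an odd doubled plus symbol of the anchor's newform» (e.g. `(a₂(A)−3)(a₂(A)+1)·L(A,1)/Ω⁺_A` odd, `…OldClassFlat.exists_odd_of_layerZero`).

## What is proved
`flatAtTwo_turnkey_prime_level`: `W/ℚ` globally minimal, `GoodSS W 2`, `a₂(W) = 0`, `Δ_W < 0`, newform `f` (eigenvalues `A p`);
an elliptic curve `A'/ℚ` with newform `g` of level `N₀` (eigenvalues `B p`), `N_{A'} ∣ N_W = N₀ · q` (`q` prime, `q ∤ N₀`), a
Galois-equivariant `W[2] ≃+ A'[2]`; parities: `B 2`, `B q` even, `A q` odd, and `A p ≡ B p (mod 2)` at the primes `p ∣ N₀`; ONE odd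
`2([b/4^k]⁺_g − [0]⁺_g)`; the named facts `buzzard2000_multiplicityOne_gamma0`, `serre1972_supersingular_decompositionSubgroup_image`,
`heckeSelfDual_torsionBy_J0`, `mazurKenku_exists_cyclic_isogeny`. THEN `2 ∤ L♭` for every Pollack pair of `f` at `2` (μ(L♭_f) = 0).
Chain: `eigenvalue_congr_two_of_geomTorsion_equiv` (hcongr off `N_W`) + `flatAtTwo_of_namedFacts_of_prime_level`.

References: [Buzzard2000LevelLoweringModTwo] Prop. 2.4; [SerreInventiones1972] Prop. 12; [DarmonDiamondTaylor1995] Lemma 1.38;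
[Mazur1978]; [EmertonPollackWeston2006] §4.4; [CremonaAlgorithms1997] §2.4, §2.8; [DiamondShurman2005] §5.7.
-/

set_option autoImplicit false
set_option linter.dupNamespace false

noncomputable section

open scoped Classical MatrixGroups ModularForm

open CongruenceSubgroup Field WeierstrassCurve Literature.NumberTheory.EllipticCurves
  Literature.NumberTheory.EllipticCurves.ModularForms Literature.NumberTheory.EllipticCurves.Rank1Residual
  Literature.NumberTheory.IwasawaTheory Summit.BirchSwinnertonDyer.Rank1Residual.Supersingular
  Summit.BirchSwinnertonDyer.BirchSwinnertonDyer.Theses.ResidualThetaTransportAtTwo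

namespace Summit.BirchSwinnertonDyer.BirchSwinnertonDyer.Theorems.SignedMuAtTwo

namespace MultOneDictionary

variable {W : WeierstrassCurve ℚ} [W.IsElliptic] [W.IsGloballyMinimal]

/-- **Per-class turnkey for FLAT at `2` at a single level-raising prime.** See the module docstring: FLAT at `(W, f)` from the
four named facts, an anchor `A'` with a Galois-equivariant `W[2] ≃+ A'[2]`, `N_{A'} ∣ N_W = N₀ q`, the parities `B 2`, `B q` even,
`A q` odd, `A p ≡ B p` at `p ∣ N₀`, and one odd doubled plus symbol of the anchor's newform `g`.
[cite: Buzzard2000LevelLoweringModTwo, Prop. 2.4] [cite: DarmonDiamondTaylor1995, §1.6 Lemma 1.38] [cite: SerreInventiones1972, §1.11 Prop. 12]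
[cite: Mazur1978, Thm. 1] [cite: EmertonPollackWeston2006, §4.4] [cite: CremonaAlgorithms1997, §2.8] -/
theorem flatAtTwo_turnkey_prime_level (hBuz : buzzard2000_multiplicityOne_gamma0)
    (hSe : serre1972_supersingular_decompositionSubgroup_image) (hSD : heckeSelfDual_torsionBy_J0)
    (hMK : mazurKenku_exists_cyclic_isogeny)
    (hss : GoodSS W 2) (ha : W.frobeniusTrace 2 = 0) (hΔ : W.Δ < 0) [NeZero (W.conductorNorm ℤ)]
    {f : CuspForm (Gamma0 (W.conductorNorm ℤ)) 2} (hf : IsNewformOf W f)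
    (A : ℕ → ℤ) (hA : ∀ p : ℕ, p.Prime → cuspCoeff f p = (A p : ℂ))
    (A' : WeierstrassCurve ℚ) [A'.IsElliptic] (hNA : A'.conductorNorm ℤ ∣ W.conductorNorm ℤ)
    (e : geomTorsion W (2 : ℕ) ≃+ geomTorsion A' (2 : ℕ))
    (he : ∀ (σ : absoluteGaloisGroup ℚ) (P : geomTorsion W (2 : ℕ)), e (σ • P) = σ • e P)
    {N₀ q : ℕ} [NeZero N₀] (hq : q.Prime) (hqN₀ : ¬ q ∣ N₀) (hN : N₀ * q = W.conductorNorm ℤ)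
    (g : CuspForm (Gamma0 N₀) 2) (hg : IsNewformOf A' g)
    (B : ℕ → ℤ) (hB : ∀ p : ℕ, p.Prime → cuspCoeff g p = (B p : ℂ)) (hB2 : Even (B 2)) (hBq : Even (B q)) (hAq : Odd (A q))
    (hcongr₀ : ∀ p : ℕ, p.Prime → p ∣ N₀ → ((A p : ℤ) : ZMod 2) = ((B p : ℤ) : ZMod 2))
    (hres : ∃ k : ℕ, 1 ≤ k ∧ ∃ b : ℤ, Odd b ∧ ∃ m : ℤ, Odd m ∧
      ratPlusSymbol g ((b : ℚ) / 4 ^ k) = ratPlusSymbol g 0 + (m : ℚ) / 2) :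
    ∀ Lplus Lminus : IwasawaAlgebra 2, IsPollackPair f 2 Lplus Lminus → ¬ PowerSeries.C (2 : ℤ_[2]) ∣ Lminus := by
  have hA2 : A 2 = 0 := by
    have := hA 2 Nat.prime_two
    rw [hf.2 2, W.LFunction_apply_prime_eq_frobeniusTrace 2 hss.1, ha] at this
    exact_mod_cast this.symm
  have hgood := eigenvalue_congr_two_of_geomTorsion_equiv W A' e he hNA hf hg A B hA hB (by rw [hA2]; exact Even.zero) hB2
  refine flatAtTwo_of_namedFacts_of_prime_level hBuz hSe hSD hMK hss ha hΔ hf A hA hq hqN₀ hN g hg.1 hg.coeffField_eq_bot B hB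
    hBq hAq (fun p hp hpq ↦ ?_) hres
  by_cases hpN : p ∣ W.conductorNorm ℤ
  · rw [← hN] at hpN
    rcases (Nat.Prime.dvd_mul hp).mp hpN with h | h
    · exact hcongr₀ p hp h
    · exact absurd ((Nat.prime_dvd_prime_iff_eq hp hq).mp h) hpq
  · exact hgood p hp hpN

end MultOneDictionary

end Summit.BirchSwinnertonDyer.BirchSwinnertonDyer.Theorems.SignedMuAtTwo

end
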